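import Summits.BirchSwinnertonDyer.Rank1Residual.Additive.DisegniLineEndStateOdd
import Summits.BirchSwinnertonDyer.Rank1Residual.Additive.TwistedBranchPAdicGrossZagierEndStateThree
import HarnessLib

/-!
# STEP C⁻(3) at `p = 3`: X3♯(G-ord) ∩ `r_an = 1` — `BSD(E,3)` with the cell's reading fact `hFact` REPLACED by
# published facts (cell `bsd-addord`, seat `bsd-addord-gz` gen 4)

HONEST FRAMING (cell `bsd-addord`; PARTITION (D-0054): EXCLUDED-DOMAIN additive rows §E (B6 = O7-ord r1) at
`p = 3`: X3♯(G-ord, e = 2) ∩ r_an = 1 ∩ ¬CM ∩ non-anomalous with the per-pair `3`-line datum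
`X3LineDatumThree W` (680 bx3g r1 keys typed, 542 non-anomalous) — types-the-object-of per E; booked 0).
THEOREMS ONLY. This is `ClassX3Gord.bsdp_three_rankOne_of_facts_of_delbourgoDatumFact[_of_lineDatum]_of_branchCoeffOneNeZero`
(TwistedBranchPAdicGrossZagierEndStateThree, p407775) with the reading fact
`Disegni2017.delbourgoDatum_rankOne_leadingTerms` REPLACED by lit's conjoined fact (B)
`Disegni2017.delbourgoDatum_cycLineGrossZagier` (its `p = 3` printed hypotheses: (G) + a good ordinary quadratic
twist, third disjunct) + `hArt` + `GrossZagier1986_thm_I_7_3` + `waldspurger_exists_heegnerField_twist_ne_zero`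
+ `exists_isNewformOf`, through the ODD kernel chain (`p = 3 ≡ 3 (mod 4)`: minus branch
`L⁻_3(f, α, ω, T)`; `DisegniLineValuesOdd` … `DisegniLineEndStateInputsOdd`). The remaining non-published
inputs are the per-pair line datum and the analytic number `BranchCoeffOneNeZeroAt W 3` (two-engine
certificates, HOME/proof/gz5-p3/).

References: [Disegni2017] Thm. A/B, (1.1.3); [Delbourgo2002] Thm. (A), (B), Hypothesis (p. 39);
[GrossZagier1986] Thm. I.(7.3); [Darmon2004] §3.9; [Wuthrich2014] Thm. 16; [GreenbergVatsal2000] Thm. (3.12).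
-/

set_option autoImplicit false

noncomputable section

open scoped Classical MatrixGroups ModularForm NumberField

open CongruenceSubgroup WeierstrassCurve NumberField IsDedekindDomain Field
  Literature.NumberTheory.EllipticCurves Literature.NumberTheory.EllipticCurves.ModularForms
  Literature.NumberTheory.EllipticCurves.GreenbergVatsal2000
  Literature.NumberTheory.EllipticCurves.Rank1Residual
  Literature.NumberTheory.EllipticCurves.Rank1Residual.Typed
  Literature.NumberTheory.EllipticCurves.Delbourgo2002
  Literature.NumberTheory.EllipticCurves.Disegni2017
  Literature.NumberTheory.GaloisRepresentations
  Summit.BirchSwinnertonDyer.Rank1Residual.AdditivePotMult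
  Summit.BirchSwinnertonDyer.Rank1Residual.Additive.X3Branch

namespace Summit.BirchSwinnertonDyer.Rank1Residual.Additive

section Three

variable {W : WeierstrassCurve ℚ} [W.IsElliptic] [W.IsGloballyMinimal]

/-- **X3♯(G-ord) (`E[3]` reducible, `e = 2`), `p = 3`, `E` non-CM, `r_an(E) = 1`, non-anomalous, the
`3`-line datum: `BSD(E,3)` from PUBLISHED named facts + ONE analytic number** — p407775's end state with
`hFact` replaced by lit's conjoined fact (B) `hCyc` (+ `hArt`, `h73`, `hWald`, `hmodN`) through the odd
kernel chain at `p = 3`. [cite: Disegni2017, Theorem A (arXiv v3 PDF pp. 7–8), Theorem B (PDF p. 9), (1.1.3) (PDF pp. 4–5)]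
[cite: Delbourgo2002, Theorem (A), (B) (p. 40); Hypothesis (p. 39)] [cite: GrossZagier1986, Thm. I.(7.3)]
[cite: Darmon2004, §3.9, proof of Thm. 3.22] [cite: Wuthrich2014, Thm. 16 (p. 397)]
[cite: GreenbergVatsal2000, §2 (11), (16), §3 Thm. (3.12) p. 45] [cite: Miller2011LMS, Def. 1.1] -/
theorem ClassX3Gord.bsdp_three_rankOne_of_facts_of_cycLineFact_of_branchCoeffOneNeZero
    [hp : Fact (Nat.Prime 3)]
    (hW16 : Wuthrich2014.thm16_halfEigenCharIdeal_dvd_cyclotomicPrime)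
    (hGV : thm312_branch_unitContent_and_lambda_eq_residual_goodOrd)
    (h23 : datumSelmer_nonPrimitive_invariants)
    (h414 : Greenberg1999.prop414_noFiniteSubmodule_of_not_dvd_torsionOrder)
    (hGrK : Greenberg1999.imKummer_ge_strictCondition_goodOrdinary)
    (hLiftE : residualEpsilon_surjOn_of_lineEven)
    (hCyc : delbourgoDatum_cycLineGrossZagier)
    (hArt : rankinSelbergEulerProductHecke_baseChangeDirichlet_eq) (h73 : GrossZagier1986_thm_I_7_3)
    (hWald : waldspurger_exists_heegnerField_twist_ne_zero)
    (hDel3 : Delbourgo2002.mainTheorem_three) (hmod : hasEntireLFunction_rat)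
    (hmodD : nonempty_modularParametrizationData) (hmodN : exists_isNewformOf)
    (hGZK : rank_eq_analyticRank_of_analyticRank_le_one)
    (hX : ClassX3Gord W 3) (hcm : ¬ W.HasCM) (hna : ReductionNonAnomalous W 3) (hr : W.analyticRank = 1)
    (Φ₀ : AddSubgroup (W.geomTorsion ((3 : ℕ) : ℤ))) (hΦ : IsRationalLine W 3 Φ₀)
    (heven : LineEven W 3 Φ₀)
    (hnt : ∃ (σ : absoluteGaloisGroup ℚ) (P : W.geomTorsion ((3 : ℕ) : ℤ)), P ∈ Φ₀ ∧ σ • P ≠ P)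
    (hram : ∀ (K : Type) [Field K] [NumberField K] [(galRange (K := ℚ) K).Normal],
      Module.finrank ℚ K = 2 →
      (∃ θ : K, θ ^ 2 = algebraMap ℚ K ((-1) ^ ((3 : ℕ) / 2) * (3 : ℕ))) →
      ¬ ∀ v : HeightOneSpectrum (𝓞 ℚ), (((3 : ℕ) : ℕ) : 𝓞 ℚ) ∈ v.asIdeal →
        ∀ 𝔓 ∈ v.primesAbove, ∀ σ ∈ 𝔓.inertia (absoluteGaloisGroup ℚ), ∀ P ∈ Φ₀,
          σ • P = (if σ ∈ galRange (K := ℚ) K then P else -P))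
    (hne : BranchCoeffOneNeZeroAt W 3) : BSDp W 3 := by
  have hpP : (3 : ℕ).Prime := hp.out
  have hp4 : (3 : ℕ) % 4 = 3 := by norm_num
  have hp2 : (3 : ℕ) ≠ 2 := by norm_num
  have he : semistabilityIndex W 3 = 2 :=
    semistabilityIndex_eq_two_of_typeG_three W hX.typeGOrd.typeG hX.addv
  -- (L) from published facts + the line data + the even-line lifting, odd branch
  obtain ⟨S₀, hS₀, hS⟩ := X2.GreenbergVatsalCaseOne.exists_finset_bad_not_mem W 3
  have hdiv : ChiBranchLowerDivisibilityOddAt W 3 :=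
    X3Branch.chiBranchLowerDivisibilityOddAt_of_facts_of_lifting hW16 hGV h23 h414 hGrK S₀ hS₀ hS Φ₀ hΦ
      heven hnt hram (fun κ S₀ hκ hS₀ hS ↦ hLiftE W 3 κ S₀ Φ₀ hΦ (by norm_num) hκ heven hS₀ hS)
  -- the twist model, its newform and period ratio; the newform of `E`
  obtain ⟨V, iV, iVm, C, hV, hC⟩ := hX.exists_goodOrd_pStar_twist_model W 3 hp2 he
  have hps : ((-1 : ℚ) ^ ((3 : ℕ) / 2) * ((3 : ℕ) : ℚ)) = -((3 : ℕ) : ℚ) := by norm_num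
  have hC' : C • V.quadraticTwist (-((3 : ℕ) : ℚ)) = W := by rw [← hps]; exact hC
  have hVW : ∃ C : VariableChange ℚ, C • V.quadraticTwist (-((3 : ℕ) : ℚ)) = W := ⟨C, hC'⟩
  have hordin : IsOrdinaryAt V 3 := ⟨hV.1, hV.2⟩
  haveI : NeZero (V.conductorNorm ℤ) := ⟨(V.conductorNorm_pos_holds).ne'⟩
  obtain ⟨Dm⟩ := hmodD V
  obtain ⟨ϖ, -, hϖ⟩ := exists_rat_mul_imaginaryPeriodRat_eq_minusPeriod Dm
  haveI : NeZero (W.conductorNorm ℤ) := ⟨(W.conductorNorm_pos_holds).ne'⟩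
  obtain ⟨DmW⟩ := hmodD W
  -- the Heegner field with `L(E^{(d_K)}, 1) ≠ 0` (Waldspurger)
  have hroot : W.rootNumber = -1 := by
    rcases rootNumber_eq_one_or_eq_neg_one W with h1 | h1
    · exfalso
      have hev1 : Even W.analyticRank :=
        (even_analyticRank_iff_rootNumber_eq_one_of_exists_isNewformOf W hmodN).mpr h1
      rw [hr] at hev1
      exact Nat.not_even_one hev1
    · exact h1
  obtain ⟨K, _, _, hK, -, hHeeg, hLd⟩ := hWald W hroot 0
  have h2 : Module.finrank ℚ K = 2 := hK.1
  haveI : IsGalois ℚ K := isGalois_of_finrank_eq_two K h2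
  have hdq : (NumberField.discr K : ℚ) ≠ 0 := by exact_mod_cast NumberField.discr_ne_zero K
  -- the Kronecker character and the twist data
  obtain ⟨κ, hκ, hκ2, hκall⟩ := exists_kroneckerChar_twistCoeff K h2
  obtain ⟨hpd, hκW, V', iV', iVm', N', _, f', hfV', hV', hap, hordV'⟩ :=
    exists_twist_newform_neg K hmodD hmodN hp4 h2 κ hκ hκall hHeeg hX.addv V hVW hV Dm.isNewformOf
  have hpdN : Nat.Coprime 3 (NumberField.discr K).natAbs :=
    (Nat.Prime.coprime_iff_not_dvd hpP).mpr fun h ↦ hpd (Int.natCast_dvd.mpr h)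
  have hS' : legendreMinusSymbolSum f' 3 ≠ 0 :=
    legendreMinusSymbolSum_ne_zero_of_twist K hmod hp4 κ hκW hX.addv V hVW Dm.isNewformOf hfV'.1
      hfV'.coeffField_eq_bot hV' hLd
  have hrd : (W.quadraticTwist (NumberField.discr K : ℚ)).mordellWeilRank = 0 := by
    haveI := W.isElliptic_quadraticTwist hdq
    have h0 : (W.quadraticTwist (NumberField.discr K : ℚ)).analyticRank = 0 :=
      (analyticRank_eq_zero_iff_holds (hmod _)).mpr hLd
    rw [(hGZK _ (by rw [h0]; exact zero_le_one)).1, h0]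
  -- the datum: lit's conjoined fact (B), `p = 3` printed hypotheses (third disjunct)
  obtain ⟨ι⟩ := PadicAlgCl.nonempty_ringEquiv_complex (p := 3)
  have hpstar : ((pStar 3 : ℤ) : ℚ) = -((3 : ℕ) : ℚ) := by rw [pStar]; norm_num
  have hCps : C • V.quadraticTwist (pStar 3 : ℚ) = W := by rw [hpstar]; exact hC'
  obtain ⟨Dh, DhK, hres, hB, hGZc⟩ := hCyc.exists_datum ι hp2 hcm hX.addv hr
    (Or.inr (Or.inr ⟨rfl, hX.typeGOrd, hX.typeGOrd.exists_goodOrd_twist_model_three hX.addv⟩))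
    hCps (Or.inl ⟨hV.1, hordin, rfl⟩) DmW.isNewformOf hK hHeeg
  -- STEP C⁻(2): the identity at `(V, f, ϖ)`
  obtain ⟨u, q, hlead, hpgz⟩ := branchPAdicGrossZagier_identity_of_cycLine_odd ι K hp4 hArt h73 hmod hGZK
    h2 κ hκ hκ2 hpdN hrd hX.addv hr V V' C hC' hV hordV' hap Dm.isNewformOf DmW.isNewformOf hfV' hV' hS' ϖ
    hϖ hres hGZc
  -- (S), lower half, upper half, glue
  have hSch : SchneiderConjecture Dh :=
    schneiderConjecture_of_identity_of_branchCoeffOneNeZero_odd hp4 hne V C hC hordin Dm.f Dm.isNewformOf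
      ϖ hϖ hpgz
  have hlow : CycLowerBoundAt W 3 Dh :=
    cycLowerBoundAt_of_chiBranchLowerOdd_of_identity W 3 hmod hGZK hX.addv hr hp4 V hVW hV Dm.isNewformOf ϖ
      hϖ hdiv hlead hpgz
  have hl : MissingLowerBoundAt W 3 :=
    missingLowerBoundAt_of_cycLowerBound W 3 hB hSch
      (fun κ' γ hκ' hγ D ↦ TypeGOrd.isTorsion_three_of_delbourgo2002 hDel3 hX.typeGOrd hX.addv hcm hκ' hγ D)
      hGZK (by rw [hr]) hna hlow
  have hu : MissingUpperBoundAt W 3 :=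
    ClassX3Gord.missingUpperBoundAt_rankOne_of_wuthrichHalf_of_identity_odd hW16 hGZK hmod hX hp4 hr hB
      hSch V hV C hC Dm.isNewformOf ϖ hϖ hlead hpgz
  exact bsdp_of_missingPPartAt W 3 hGZK (by rw [hr]) (missingPPartAt_of_lower_of_upper W 3 hl hu)

/-- **`p = 3` with the line datum as ONE predicate** (per-pair records `x3LineDatumThree_<label>`, 680
filed): `BSD(E,3)` on X3♯(G-ord, `e = 2`) ∩ `r_an = 1`, `E` non-CM, non-anomalous, from PUBLISHED facts +
`X3LineDatumThree W` + `BranchCoeffOneNeZeroAt W 3` — hFact replaced as above.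
[cite: Delbourgo2002, Theorem (A), (B) (p. 40)] [cite: Disegni2017, Theorem A/B (arXiv v3 PDF 7–9)]
[cite: GreenbergVatsal2000, §2 (11), (16), pp. 28–30, §3 Thm. (3.12) p. 45] [cite: Wuthrich2014, Thm. 16 (p. 397)]
[cite: Miller2011LMS, Def. 1.1] -/
theorem ClassX3Gord.bsdp_three_rankOne_of_facts_of_cycLineFact_of_lineDatum_of_branchCoeffOneNeZero
    [Fact (Nat.Prime 3)]
    (hW16 : Wuthrich2014.thm16_halfEigenCharIdeal_dvd_cyclotomicPrime)
    (hGV : thm312_branch_unitContent_and_lambda_eq_residual_goodOrd)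
    (h23 : datumSelmer_nonPrimitive_invariants)
    (h414 : Greenberg1999.prop414_noFiniteSubmodule_of_not_dvd_torsionOrder)
    (hGrK : Greenberg1999.imKummer_ge_strictCondition_goodOrdinary)
    (hLiftE : residualEpsilon_surjOn_of_lineEven)
    (hCyc : delbourgoDatum_cycLineGrossZagier)
    (hArt : rankinSelbergEulerProductHecke_baseChangeDirichlet_eq) (h73 : GrossZagier1986_thm_I_7_3)
    (hWald : waldspurger_exists_heegnerField_twist_ne_zero)
    (hDel3 : Delbourgo2002.mainTheorem_three) (hmod : hasEntireLFunction_rat)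
    (hmodD : nonempty_modularParametrizationData) (hmodN : exists_isNewformOf)
    (hGZK : rank_eq_analyticRank_of_analyticRank_le_one)
    (hX : ClassX3Gord W 3) (hcm : ¬ W.HasCM) (hna : ReductionNonAnomalous W 3) (hr : W.analyticRank = 1)
    (hL : X3LineDatumThree W) (hne : BranchCoeffOneNeZeroAt W 3) : BSDp W 3 := by
  obtain ⟨Φ₀, hΦ, heven, hnt, hram⟩ := hL
  exact ClassX3Gord.bsdp_three_rankOne_of_facts_of_cycLineFact_of_branchCoeffOneNeZero hW16 hGV h23 h414
    hGrK hLiftE hCyc hArt h73 hWald hDel3 hmod hmodD hmodN hGZK hX hcm hna hr Φ₀ hΦ heven hnt hram hne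

end Three

end Summit.BirchSwinnertonDyer.Rank1Residual.Additive

end
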